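import Summits.ResolutionOfSingularities.ResolutionOfSingularities.Theorems.WeightedInvariantLocalWeightedDropNCArrangementsMove
import Summits.ResolutionOfSingularities.ResolutionOfSingularities.Theorems.WeightedInvariantLocalWeightedDropSpaceCountGameInvariance
import Summits.ResolutionOfSingularities.ResolutionOfSingularities.Theorems.WeightedInvariantLocalWeightedDropNCGameTransport

/-!
# `LocalWeightedDrop`, line `nc-game-transport`: TOT RUNG R2 — HYPERPLANE ARRANGEMENTS ARE WON IN THE NC COUNT GAME
# (every number of variables, every field, char-free), hence in the weighted game

[OURS · L1 W4.3 · chain w43, engine crux `LocalWeightedDrop` stmt-ResolutionOfSingularities-8899; strategist res-L1-w43-strat-1's line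
`nc-game-transport` (`L/res-L1-w43-strat-1/nc_game_transport_v2.lean`, stubs `NCTransport.stub_totFour` / `stub_totFiveUp` = finite-round
NC-winnability of every non-zero germ in `≥ 4` variables, OPEN IN PRINT), rung spec `TOT-RUNGS-SPEC.md` §R2, ORDERS-BY-NAME 07:20:08Z →
res-type-088.]  A RUNG = a sorry-free class of germs won in finitely many rounds of the count game `TameFourTupleDrop.WinsIn GermIsNC`
(positions = germs; move = legal coordinate change + weights `≤ 1`; answer = exceptional point + `s`-saturation; new position = `s ·` sliced
strict transform; terminal = normal-crossing support) in a number of variables where the weighted residual (`Won k 4`, wild germs) is not a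
tree theorem.  NOT a statement of any manuscript; both games are the programme's own.  THIS FILE CLOSES NO STUB BY NAME.

**THE RUNG.**  For every field `k`, every `m`, every finite family of non-zero linear forms `ℓ_j = Σᵢ a_{j,i} xᵢ` (`j ∈ s`; repetitions and
proportional forms allowed) in `k⟦x₀,…,x_m⟧`:
* `winsIn_prod_linForm` — `WinsIn GermIsNC (nullity k a s) (∏_{j ∈ s} ℓ_j)` with `nullity = |s| − rank (span of the coefficient vectors)`;
* `winsIn_arrangement` — the same for `u · ∏ ℓ_j`, `u(0) ≠ 0`; `winsIn_of_dvd_arrangement_pow` — and for EVERY DIVISOR OF A POWER of it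
  (all multiplicities `∏ ℓ_j^{m_j}` in particular), by radical transport (`winsIn_of_dvd_pow`, heredity (N1) `germIsNC_of_dvd_pow`);
* `won_of_dvd_arrangement_pow` — hence, over a field of characteristic `p`, every divisor of a power of a hyperplane arrangement is WON in
  the local weighted resolution game `CobordantGame.Won k (m + 1)` (the landed transport `NCTransport.won_of_winsIn`, p507842) —
  unconditionally and in every dimension (the engine's closed layers are `N ≤ 3` and tame `N = 4`, both modulo ⟨F-32bR⟩; wild arrangements
  in four variables, `p ∣ Σ m_j`, are instances of the open residual W4|₄).

**THE STRATEGY (OURS; measure = NULLITY, not the spec's component count).**  If the coefficient vectors on `s` are linearly independent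
the forms are coordinates after a linear change (`exists_matrix_of_linearIndependent`) and the product is a monomial: NC.  Otherwise split
`s = core ⊔ coloops` (a coloop is a form outside the span of the others); the spans of core and coloops meet trivially, so an ADAPTED
invertible linear change (`exists_adapted_matrix`) puts the core forms on a coordinate block `S` (which they span) and the coloops off
`S`.  MOVE: weights `𝟙_S` — the centre is the flat of the core, NOT the origin (the origin stalls: `x·y·(x+y)·z`).  At an exceptional point
`c ≠ 0` (on `S`) the transform is `s^{|core|} · G₀`, `G₀ = ∏_{core} (ℓ_j(c) + ℓ_j(y′)) · ∏_{coloops} ℓ_j(y′)`, `s ∤ G₀`; the mover slices at a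
live slot `l` (`c_l ≠ 0`); the new position is a unit (the core forms with `ℓ_j(c) ≠ 0` — there is one, the core spans `S ∋ c`) times
`s · ∏_{core, ℓ_j(c) = 0} ℓ_j| · ∏_{coloops} ℓ_j|`: again an arrangement, whose nullity is `ν(core_c) + ν(coloops) < ν(core) + ν(coloops)
= ν(s)` because the core is coloop-free in itself and loses at least one form (`nullity_new_lt`).  No characteristic enters.
-/

set_option linter.dupNamespace false -- mandated namespace of this single-conjunct summit

namespace Summit.ResolutionOfSingularities.ResolutionOfSingularities.Theorems

namespace NCArrangement

open MvPowerSeries Matrix Module Submodule Literature.AlgebraicGeometry.Resolution TameFourTupleDrop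

variable {k : Type} [Field k] {m : ℕ} {ι : Type} [DecidableEq ι]

/-! ## Base: independent forms are coordinates -/

omit [DecidableEq ι] in
/-- NULLITY ZERO ⇒ NORMAL CROSSINGS: linearly independent linear forms are coordinates after a linear change, so their product is a
monomial. -/
theorem germIsNC_prod_linForm {a : ι → Fin (m + 1) → k} {s : Finset ι} (h : nullity k a s = 0) :
    GermIsNC (∏ j ∈ s, linForm (a j)) := by
  classical
  have hli := linearIndependent_of_nullity_eq_zero h
  obtain ⟨Q, σ, hdet, -, hcoord⟩ := exists_matrix_of_linearIndependent hli
  have hdet' : IsUnit (Q⁻¹).det := Matrix.isUnit_nonsing_inv_det Q hdet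
  refine ⟨FormalCoordChange.linSubst Q⁻¹, 1,
    fun i => (Finset.univ.filter (fun j : ↥s => σ j = i)).card, constantCoeff_linSubst Q⁻¹, ?_,
    by rw [map_one]; exact one_ne_zero, ?_⟩
  · rw [linMat_linSubst]; exact hdet'
  · rw [subst_linSubst_prod_linForm, one_mul, ← Finset.prod_coe_sort s]
    simp_rw [hcoord, linForm_single]
    rw [← Finset.prod_fiberwise' Finset.univ σ (fun i => (X i : MvPowerSeries (Fin (m + 1)) k))]
    exact Finset.prod_congr rfl fun i _ => Finset.prod_const _

/-! ## The game -/

/-- THE ARRANGEMENT GAME (induction on the round budget `N ≥ nullity`). -/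
theorem winsIn_prod_linForm_of_le :
    ∀ (N : ℕ) (s : Finset ι) (a : ι → Fin (m + 1) → k), (∀ j ∈ s, a j ≠ 0) → nullity k a s ≤ N →
      WinsIn GermIsNC N (∏ j ∈ s, linForm (a j)) := by
  classical
  intro N
  induction N with
  | zero =>
    intro s a _ hν
    exact (winsIn_zero _ _).mpr (germIsNC_prod_linForm (Nat.le_zero.mp hν))
  | succ N ih =>
    intro s a ha hν
    by_cases hle : nullity k a s ≤ N
    · exact WinsIn.mono (Nat.le_succ N) (ih s a ha hle)
    have hpos : 0 < nullity k a s := by omega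
    -- core / coloops and the adapted coordinates
    set B := core k a s with hBdef
    set L := coloops k a s with hLdef
    have hBL : Disjoint B L := disjoint_core_coloops
    have hBLs : B ∪ L = s := core_union_coloops
    have hBne : B.Nonempty := core_nonempty hpos
    set W₁ : Submodule k (Fin (m + 1) → k) := span k (a '' (↑B : Set ι)) with hW₁
    set W₂ : Submodule k (Fin (m + 1) → k) := span k (a '' (↑L : Set ι)) with hW₂
    obtain ⟨Q, hr, hdet, hrows, hW₁off, hW₂on⟩ :=
      exists_adapted_matrix W₁ W₂ disjoint_span_core_coloops (finBasis k W₁)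
    set r := finrank k W₁ with hrdef
    have hdet' : IsUnit (Q⁻¹).det := Matrix.isUnit_nonsing_inv_det Q hdet
    set α : ι → Fin (m + 1) → k := fun j => a j ᵥ* Q⁻¹ with hαdef
    have hαf : ∀ j, α j = Matrix.vecMulLinear Q⁻¹ (a j) := fun j => rfl
    have hαne : ∀ j ∈ B ∪ L, α j ≠ 0 := fun j hj => vecMul_inv_ne_zero hdet (ha j (hBLs ▸ hj))
    have hBsupp : ∀ j ∈ B, ∀ i : Fin (m + 1), r ≤ i.val → α j i = 0 :=
      fun j hj i hi => hW₁off (a j) (subset_span ⟨j, hj, rfl⟩) i hi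
    have hLsupp : ∀ j ∈ L, ∀ i : Fin (m + 1), i.val < r → α j i = 0 :=
      fun j hj i hi => hW₂on (a j) (subset_span ⟨j, hj, rfl⟩) i hi
    -- the core stays coloop-free in the new coordinates
    have hBfree : ∀ j ∈ B, α j ∈ span k (α '' (↑(B.erase j) : Set ι)) := by
      intro j hj
      have himg : α '' (↑(B.erase j) : Set ι) = Matrix.vecMulLinear Q⁻¹ '' (a '' (↑(B.erase j) : Set ι)) := by
        rw [Set.image_image]
        exact Set.image_congr fun j' _ => hαf j'
      rw [himg, Submodule.span_image]
      exact Submodule.mem_map_of_mem (mem_span_core_erase hj)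
    -- non-degeneracy: a non-zero `c` on the block pairs non-trivially with some core form
    have hnondeg : ∀ c : Fin (m + 1) → k, (∀ i : Fin (m + 1), r ≤ i.val → c i = 0) →
        (∀ j ∈ B, α j ⬝ᵥ c = 0) → c = 0 := by
      intro c hc hB0
      -- the functional `v ↦ (v ᵥ* Q⁻¹) ⬝ᵥ c` kills `a '' B`, hence `W₁`, hence the rows `Q i`, `i < r`
      have hW : ∀ v ∈ W₁, (v ᵥ* Q⁻¹) ⬝ᵥ c = 0 := by
        intro v hv
        induction hv using Submodule.span_induction with
        | mem x hx =>
          obtain ⟨j, hj, rfl⟩ := hx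
          exact hB0 j hj
        | zero => rw [Matrix.zero_vecMul, zero_dotProduct]
        | add x y _ _ hx hy => rw [Matrix.add_vecMul, add_dotProduct, hx, hy, add_zero]
        | smul t x _ hx => rw [Matrix.smul_vecMul, smul_dotProduct, hx, smul_zero]
      funext i
      by_cases hi : i.val < r
      · have hrow := hW (Q (Fin.castLE hr ⟨i.val, hi⟩)) (by rw [hrows]; exact Submodule.coe_mem _)
        rw [row_vecMul_inv hdet, single_dotProduct, one_mul] at hrow
        have : Fin.castLE hr ⟨i.val, hi⟩ = i := Fin.ext rfl
        rw [this] at hrow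
        exact hrow
      · exact hc i (by omega)
    -- `r ≥ 1`
    obtain ⟨j₁, hj₁⟩ := hBne
    have hr1 : 0 < r := by
      by_contra h0
      exact hαne j₁ (Finset.mem_union_left _ hj₁) (funext fun i => hBsupp j₁ hj₁ i (by omega))
    -- change coordinates, then play the move `(X, 𝟙_S)`
    refine winsIn_germIsNC_of_subst (Ψ := FormalCoordChange.linSubst Q⁻¹) (constantCoeff_linSubst Q⁻¹)
      (by rw [linMat_linSubst]; exact hdet') (N + 1) _ ?_
    rw [subst_linSubst_prod_linForm, ← hBLs]
    change WinsIn GermIsNC (N + 1) (∏ j ∈ B ∪ L, linForm (α j))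
    have hmv : IsCountMove (m := m) (fun i => (X i : MvPowerSeries (Fin (m + 1)) k)) (blockWeight m r) := by
      refine ⟨fun i => constantCoeff_X i, TupleMonomialPhase.isUnit_det_X, fun i => ?_, ⟨⟨0, by omega⟩, ?_⟩⟩
      · rw [blockWeight_apply]; split_ifs <;> omega
      · rw [blockWeight_apply, if_pos (by simpa using hr1)]; exact one_pos
    refine winsIn_move hmv ?_
    intro c hc hc0 A G hfac hG
    rw [MvPowerSeries.subst_self] at hfac
    simp only [id_eq] at hfac
    have hcsupp : ∀ i : Fin (m + 1), r ≤ i.val → c i = 0 := fun i hi => hc i (by rw [blockWeight_apply, if_neg (by omega)])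
    -- the saturation is `(|B|, G₀)`
    have hcomp := subst_chart_prod hc hBL hBsupp hLsupp
    obtain ⟨-, hGG₀⟩ := X_pow_mul_eq_X_pow_mul (0 : Fin (m + 1 + 1)) (hfac.symm.trans hcomp) hG (not_X_dvd_G₀ c hαne)
    -- a core form not vanishing at `c`, and a live slot
    obtain ⟨j₀, hj₀, hj₀c⟩ : ∃ j₀ ∈ B, α j₀ ⬝ᵥ c ≠ 0 := by
      by_contra h
      push Not at h
      exact hc0 (hnondeg c hcsupp h)
    obtain ⟨l, hl, hcl⟩ : ∃ l : Fin (m + 1), l.val < r ∧ c l ≠ 0 := by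
      by_contra h
      push Not at h
      exact hc0 (funext fun i => by
        by_cases hi : i.val < r
        · exact h i hi
        · exact hcsupp i (by omega))
    refine ⟨l, hcl, ?_⟩
    rw [hGG₀, X_mul_slice_G₀ c l hBL hj₀ hj₀c]
    refine winsIn_germIsNC_unit_mul N _ _
      (constantCoeff_unitPart c l _ fun j hj => (Finset.mem_filter.mp hj).2) (ih _ _ ?_ ?_)
    · exact newVec_ne_zero hl hcl hLsupp hαne j₀
    · have := nullity_new_lt hl hcl hBL hBsupp hLsupp hBfree hj₀ hj₀c
      have hνα : nullity k α (B ∪ L) = nullity k a s := by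
        rw [hBLs, nullity_congr (s := s) (fun j _ => hαf j)]
        exact nullity_comp_eq (Matrix.vecMulLinear Q⁻¹) fun v _ hv =>
          (Matrix.vecMul_injective_iff_isUnit.mpr ((Matrix.isUnit_iff_isUnit_det _).mpr hdet'))
            (show v ᵥ* Q⁻¹ = (0 : Fin (m + 1) → k) ᵥ* Q⁻¹ by rw [Matrix.zero_vecMul]; exact hv)
      omega

/-- **R2 — HYPERPLANE ARRANGEMENTS ARE WON IN THE NC COUNT GAME** (OURS · L1 W4.3, line `nc-game-transport`): over ANY field, in any
number of variables, the product of any finite family of non-zero linear forms is brought to normal-crossing support within `nullity` rounds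
(`nullity = |s| − rank` of the coefficient vectors; repetitions and proportional forms allowed). -/
theorem winsIn_prod_linForm (s : Finset ι) (a : ι → Fin (m + 1) → k) (ha : ∀ j ∈ s, a j ≠ 0) :
    WinsIn GermIsNC (nullity k a s) (∏ j ∈ s, linForm (a j)) :=
  winsIn_prod_linForm_of_le _ s a ha le_rfl

/-- The same with a unit factor: `u · ∏ ℓ_j`, `u(0) ≠ 0`. -/
theorem winsIn_arrangement (u : MvPowerSeries (Fin (m + 1)) k) (hu : constantCoeff u ≠ 0) (s : Finset ι) (a : ι → Fin (m + 1) → k)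
    (ha : ∀ j ∈ s, a j ≠ 0) : WinsIn GermIsNC (nullity k a s) (u * ∏ j ∈ s, linForm (a j)) :=
  winsIn_germIsNC_unit_mul _ _ u hu (winsIn_prod_linForm s a ha)

omit [DecidableEq ι] in
/-- A hyperplane arrangement germ is non-zero. -/
theorem arrangement_ne_zero (u : MvPowerSeries (Fin (m + 1)) k) (hu : constantCoeff u ≠ 0) (s : Finset ι) (a : ι → Fin (m + 1) → k)
    (ha : ∀ j ∈ s, a j ≠ 0) : u * ∏ j ∈ s, linForm (a j) ≠ 0 := by
  refine mul_ne_zero (fun h => hu (by rw [h, map_zero])) (Finset.prod_ne_zero_iff.mpr fun j hj => linForm_ne_zero (ha j hj))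

/-- **EVERY DIVISOR OF A POWER OF A HYPERPLANE ARRANGEMENT** — in particular `u · ∏ ℓ_j^{m_j}` with arbitrary multiplicities — is won in
the NC count game within `nullity` rounds (radical transport `winsIn_of_dvd_pow` with the heredity (N1) of normal-crossing support). -/
theorem winsIn_of_dvd_arrangement_pow (u : MvPowerSeries (Fin (m + 1)) k) (hu : constantCoeff u ≠ 0) (s : Finset ι)
    (a : ι → Fin (m + 1) → k) (ha : ∀ j ∈ s, a j ≠ 0) (N : ℕ) (f : MvPowerSeries (Fin (m + 1)) k)
    (hf : f ∣ (u * ∏ j ∈ s, linForm (a j)) ^ (N + 1)) : WinsIn GermIsNC (nullity k a s) f :=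
  winsIn_of_dvd_pow (fun N b d hd hnc hbd => germIsNC_of_dvd_pow N b d hd hnc hbd) _ N f _
    (arrangement_ne_zero u hu s a ha) (winsIn_arrangement u hu s a ha) hf

/-- **THE SPEC'S SHAPE `u · ∏ ℓ_j^{m_j}`**: a hyperplane arrangement with arbitrary multiplicities is won in the NC count game within
`nullity` rounds. -/
theorem winsIn_arrangement_pow (u : MvPowerSeries (Fin (m + 1)) k) (hu : constantCoeff u ≠ 0) (s : Finset ι)
    (a : ι → Fin (m + 1) → k) (ha : ∀ j ∈ s, a j ≠ 0) (e : ι → ℕ) :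
    WinsIn GermIsNC (nullity k a s) (u * ∏ j ∈ s, linForm (a j) ^ e j) := by
  refine winsIn_of_dvd_arrangement_pow u hu s a ha (s.sup e) _ ?_
  rw [mul_pow, ← Finset.prod_pow]
  refine mul_dvd_mul (dvd_pow_self u (Nat.succ_ne_zero _)) (Finset.prod_dvd_prod_of_dvd _ _ fun j hj => ?_)
  exact pow_dvd_pow _ ((Finset.le_sup hj).trans (Nat.le_succ _))

/-- **TOT-SHAPE COROLLARY**: every divisor of a power of a hyperplane arrangement is won in finitely many rounds. -/
theorem exists_winsIn_of_dvd_arrangement_pow (u : MvPowerSeries (Fin (m + 1)) k) (hu : constantCoeff u ≠ 0) (s : Finset ι)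
    (a : ι → Fin (m + 1) → k) (ha : ∀ j ∈ s, a j ≠ 0) (N : ℕ) (f : MvPowerSeries (Fin (m + 1)) k)
    (hf : f ∣ (u * ∏ j ∈ s, linForm (a j)) ^ (N + 1)) : ∃ n, WinsIn GermIsNC n f :=
  ⟨_, winsIn_of_dvd_arrangement_pow u hu s a ha N f hf⟩

/-- **R2 IN THE WEIGHTED GAME**: over a field of characteristic `p`, every divisor of a power of a hyperplane arrangement in `m + 1`
variables is WON in the local weighted resolution game (through the landed transport `NCTransport.won_of_winsIn`) — unconditionally (no
⟨F-32bR⟩), in every dimension; WILD arrangements in four variables (`p ∣ Σ m_j`, e.g. `x₀x₁(x₀+x₁)x₂` for `p = 2`) are instances of the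
engine's open residual W4|₄ `stub_wildWideApexFourStartsWon` covered by no closed layer of the engine. -/
theorem won_of_dvd_arrangement_pow (p : ℕ) (hp : p.Prime) [CharP k p] (u : MvPowerSeries (Fin (m + 1)) k)
    (hu : constantCoeff u ≠ 0) (s : Finset ι) (a : ι → Fin (m + 1) → k) (ha : ∀ j ∈ s, a j ≠ 0) (N : ℕ)
    (f : MvPowerSeries (Fin (m + 1)) k) (hf : f ∣ (u * ∏ j ∈ s, linForm (a j)) ^ (N + 1)) :
    CobordantGame.Won k (m + 1) f :=
  NCTransport.won_of_winsIn p hp _ _ (arrangement_ne_zero u hu s a ha) (winsIn_arrangement u hu s a ha) N f hf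

end NCArrangement

end Summit.ResolutionOfSingularities.ResolutionOfSingularities.Theorems
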